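import Summits.Ventures.PercRepro.ProfilePointedCircuitClassesReplacementPair

/-!
# PercRepro — THE ONE-POINT CASE OF (PS) UP TO A FACTOR TWO (`n = 10`, `ρ = 6`, no coloops)
(p5, gen 46; `proofs/P5-GM1.md` §68 ADDENDUM 2)

For a point `c ≠ e` of a coloop-free matroid with `10` points and rank `6`:
`thru_4({c, e}) ≤ 2 · #{T ∈ BI_5 : c ∈ T, e ∉ T}` (`thruCount_four_pair_le_two_mul`) — the same double counting as
for two-point sets (every demand `X ∋ c, e` has at least three units `T ⊇ X − e` avoiding `e`), but a unit `T ∋ c`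
now has at most `C(4, 2) = 6` demands below it (`X ↦ X ∖ {c, e}` into the two-point subsets of `T ∖ {c}`), so the
constants are `3` and `6`.  The sharp form `thru_4({c, e}) ≤ #{T ∈ BI_5 : c ∈ T, e ∉ T}` is census-true
(§68 ADDENDUM 2) and, like the `n = 10` theorem itself, needs a charging: the bound `3` on the replacement units is
attained while the local LYM fails.
-/

open scoped Matroid

namespace PercRepro.Cogirth

open Finset ThmH Skew Shadow Profile

variable {α : Type} [DecidableEq α] {N : Matroid α} [N.Finite]

section ReplacementSingle

/-- **THE ONE-POINT CASE OF (PS) UP TO A FACTOR TWO**: on a coloop-free matroid with `#E = 10` and `ρ = 6`, for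
every `c ≠ e`, the bi-independent `4`-sets through `{c, e}` are at most twice the bi-independent `5`-sets containing
`c` and avoiding `e`. -/
theorem thruCount_four_pair_le_two_mul (hn : (gr N).card = 10) (hR : rk N (gr N) = 6)
    (hcf : ∀ x ∈ gr N, rk N ((gr N).erase x) = 6) {c e : α} (hce : c ≠ e) :
    thruCount N 4 ({c, e} : Finset α) ≤ 2 * ((biIndepSets N 5).filter (fun T => c ∈ T ∧ e ∉ T)).card := by
  unfold thruCount
  have hec : e ∉ ({c} : Finset α) := by
    rw [mem_singleton]
    exact fun h => hce h.symm
  have hpair : ({c, e} : Finset α) = insert e {c} := by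
    rw [pair_comm]
  have key : ((biIndepSets N 4).filter (fun X => ({c, e} : Finset α) ⊆ X)).card * 3 ≤
      ((biIndepSets N 5).filter (fun T => c ∈ T ∧ e ∉ T)).card * 6 := by
    refine card_mul_le_card_mul (fun (X T : Finset α) => X.erase e ⊆ T) ?_ ?_
    · -- every demand has at least three units above it
      intro X hX
      rw [mem_filter] at hX
      have he : e ∈ X := hX.2 (by rw [mem_insert, mem_singleton]; exact Or.inr rfl)
      have hc : c ∈ X := hX.2 (mem_insert_self c {e})
      have h3 := three_le_card_filter_replacement hn hR hcf hX.1 he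
      refine h3.trans (card_le_card ?_)
      intro T hT
      rw [mem_filter] at hT
      rw [mem_bipartiteAbove, mem_filter]
      exact ⟨⟨hT.1, hT.2.2 (mem_erase.2 ⟨hce, hc⟩), hT.2.1⟩, hT.2.2⟩
    · -- every unit has at most six demands below it
      intro T hT
      rw [mem_filter] at hT
      have hTc : (T.erase c).card = 4 := by
        rw [card_erase_of_mem hT.2.1, (mem_biIndepSets.1 hT.1).2.1]
      calc (((biIndepSets N 4).filter (fun X => ({c, e} : Finset α) ⊆ X)).bipartiteBelow
            (fun (X T : Finset α) => X.erase e ⊆ T) T).card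
          ≤ ((T.erase c).powersetCard 2).card := ?_
        _ = 6 := by
          rw [card_powersetCard, hTc]
          decide
      apply card_le_card_of_injOn (fun X => X \ ({c, e} : Finset α))
      · intro X hX
        rw [mem_coe, mem_bipartiteBelow, mem_filter] at hX
        obtain ⟨⟨hX4, hXC⟩, hXT⟩ := hX
        show X \ ({c, e} : Finset α) ∈ (T.erase c).powersetCard 2
        rw [mem_powersetCard]
        refine ⟨?_, ?_⟩
        · intro x hx
          rw [mem_sdiff, mem_insert, mem_singleton, not_or] at hx
          rw [mem_erase]
          exact ⟨hx.2.1, hXT (mem_erase.2 ⟨hx.2.2, hx.1⟩)⟩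
        · rw [card_sdiff_of_subset hXC, (mem_biIndepSets.1 hX4).2.1, hpair, card_insert_of_notMem hec,
            card_singleton]
      · intro X₁ hX₁ X₂ hX₂ h
        rw [mem_coe, mem_bipartiteBelow, mem_filter] at hX₁ hX₂
        have h₁ : X₁ \ ({c, e} : Finset α) ∪ {c, e} = X₁ := sdiff_union_of_subset hX₁.1.2
        have h₂ : X₂ \ ({c, e} : Finset α) ∪ {c, e} = X₂ := sdiff_union_of_subset hX₂.1.2
        rw [← h₁, ← h₂]
        exact congrArg (fun S => S ∪ ({c, e} : Finset α)) h
  omega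

end ReplacementSingle

end PercRepro.Cogirth
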